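import Summits.QuantumFields.YangMills.Theorems.BalabanUVNodesK0RecordFormatNames

/-!
# K0⁷ — THE RECORD-SIDE FORMAT NAMES (WORLD A), LEMMA FILE: ROW (A3) chart input-locality PROVED, ROW (Mc), the `rfl` faces of ROW Gk ∕ (N) ∕ (W-labels),
# the coordinate round trips, the `spaceI` bridge, the flat point of the chart, the nearest-cube spec, and the linearity of the chart data

Cell `ym-nodeO-ideate`, DEFINER seat `ym-nodeO-def-1` (gen 33), director-ym №440 SUMMON task (2) «the (A3) dictionary lemma in the same or a sibling module»;
sibling of the definitions-only module `BalabanUVNodesK0RecordFormatNames` (statement-form rule: proofs live here); `--kind proof --supports stmt-QuantumFields-20541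
--as helper`; count-neutral.  [I] = [Balaban1987RG1].

CONTENTS.  §1 `decodeCfg_encodeCfg` ∕ `encodeCfg_decodeCfg` (the coordinates are a bijection onto 11b's `Sect2.CPair`); `recordUc_eq_preimage_spaceI` (the spaces of
record ARE the pull-back of 11b's `Sect2.spaceI` at any setting with the record's model and (1.12) constant).  §2 ★ `recordChart_inputLocal` = lens-1's ROW (A3)
`ChartInputLocal (cX K) (coords K) (χ K)` at the names, PROVED (definitional for the coordinatewise chart); `decodeCfg_recordChart_zero` (the chart origin is the
unit configuration `(1, 0)` — the flat point (O2′) speaks about).  §3 the faces: `recordGk_eq` (ROW Gk, `rfl`), `recordE_eq` (ROW (W-labels), `rfl`), `recordN_eq`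
(ROW (N), `rfl`), `rowMc` ∕ `mcGuard_pow` (ROW (Mc)), `recordPick_spec` ∕ `recordSiteGeom_distD_le` (the nearest cube minimises), `recordAd_apply` (`rfl`).
§4 linearity: `sl2Coord_add ∕ _smul`, `chartMat_add ∕ _smul`.  §5 (v2) the VOLUME SHIFT:
`pow_mul_dvd_sitesPerDir` ∕ `domCount_mul_side_eq` (from `recordK₀ F Mc k` on, the `Mc`-cubes tile `T_K` exactly; the torus side is the tree's
`T4Family.sitesPerDir_eq`) and `rowMc_cofinal` (ROW (Mc) cofinal).  §6 (v3) `treeLeaf_recordCc` (ROW (LeavesT) at the names = the tree's `hTree_torus`, constant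
`K₀(4·2⁴, 8)` uniform in every letter) and the structural half of the repaired 27932‴: `recordDom44` is CONVEX, BALANCED, OPEN (`convex_balanced_isOpen_recordDom44`)
and contains `0` for `α₂ > 0` (`zero_mem_recordDom44`).  §7 (v3) `chart44DAt_iff` (`Iff.rfl` to typer-1's tree `Chart44D`) and NamesAgree′ ∕ ROW Gk ∕ ROW (W-labels)
faces (`rfl`) for the CENTRED record instance `recordResponse9Data(From)Ctr` of `B12FormatPlus.Response9Data`; §8 (v3) the centred window: base cube
off the seam, seam cubes at distance `≥ recordR ≥ N∕4` on the tiled range, window labels carried to window labels.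

HONEST FRAMING.  Bookkeeping about NAMES; nothing of Bałaban asserted, ported or discharged; texts 27930⁗∕27931‴∕27932″ UNSIGNED; K0⁷ NOT closed; NODE O 0∕1;
COUNT 8∕28 · K 1∕4 UNMOVED; finite `𝕋⁴_{L^K}` at fixed ε — NOT continuum ∕ ℝ⁴ ∕ OS; **the Yang–Mills mass gap (Clay) is NOT proved by any of this.**
No `sorry`; standard axioms.
-/

noncomputable section

open scoped BigOperators Matrix.Norms.L2Operator

namespace Summit.QuantumFields.YangMills.Theorems.K0RecordFormatNames

open Literature.MathematicalPhysics.QuantumFieldTheory.Balaban1983to89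
open Literature.MathematicalPhysics.QuantumFieldTheory.Balaban1983to89.Node00
open Literature.MathematicalPhysics.QuantumFieldTheory.Balaban1983to89.T4Continuum (T4Family)
open Literature.MathematicalPhysics.QuantumFieldTheory.Balaban1983to89.TreeLengthTorus (TPt)
open NormedSpace (exp)

variable (F : T4Family)

/-! ## §1  Coordinate round trips and the `spaceI` bridge -/

/-- `decode ∘ encode = id`. [cite: Balaban1987RG1, (1.9) p.262 (bookkeeping)] -/
@[simp] theorem decodeCfg_encodeCfg (K : ℕ) (φ : Sect2.CPair (F.P K) (MatA 2)) : decodeCfg F K (encodeCfg F K φ) = φ := by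
  ext b i j <;> simp [decodeCfg, encodeCfg]

/-- `encode ∘ decode = id`. [cite: Balaban1987RG1, (1.9) p.262 (bookkeeping)] -/
@[simp] theorem encodeCfg_decodeCfg (K : ℕ) (u : Fin (recordBondCount F K) → ℂ) : encodeCfg F K (decodeCfg F K u) = u := by
  ext n
  have hn : cfgEquiv F K ((cfgEquiv F K).symm n) = n := Equiv.apply_symm_apply _ _
  rcases hc : (cfgEquiv F K).symm n with ⟨b | b, i, j⟩ <;> rw [hc] at hn <;> simp [encodeCfg, decodeCfg, hc, hn]

/-- `recordUc` IS the coordinate pull-back of 11b's `Sect2.spaceI` at any setting with the record's model and (1.12) constant (e.g. `settingOfRecord₁₁` at a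
Stage-11 view of the record's θ). [cite: Balaban1987RG1, (1.11)–(1.16) p.262 (bookkeeping)] -/
theorem recordUc_eq_preimage_spaceI (S : Sect2.Setting (MatA 2) (SU 2)) (h𝓜 : S.𝓜 = B12RegularSpaces111SpecialUnitary.suModel 2)
    (hcB : S.cB = recordCB F) (Mc k : ℕ) (α₀ α₁ : ℝ) (K : ℕ) (X : (recordDomSys F Mc k K).Dom) :
    recordUc F Mc k α₀ α₁ K X =
      decodeCfg F K ⁻¹' Sect2.spaceI S (RzOfRecord F 2 K) Mc (k + 1) (Sect2.domSites (F.P K) Mc (k + 1) X) α₀ α₁ := by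
  rw [recordUc, Sect2.spaceI, h𝓜, hcB]

/-! ## §2  ROW (A3) proved, and the flat point of the chart -/

/-- **ROW (A3) — CHART INPUT-LOCALITY, proved** (lens-1's `ChartInputLocal (recordCX …) (recordCoords …) (recordChart …)`, definitional for the coordinatewise chart):
the coordinates in `X` of the charted configuration read only the chart inputs in `cX X`. [cite: Balaban1987RG1, (1.7) p.261, (4.3) p.281] -/
theorem recordChart_inputLocal (Mc k K : ℕ) (X : (recordDomSys F Mc k K).Dom) (u u' : Fin (recordChartDim F K) → ℂ)
    (h : ∀ i ∈ recordCX F Mc k K X, u i = u' i) :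
    ∀ n ∈ recordCoords F Mc k K X, recordChart F Mc k K X u n = recordChart F Mc k K X u' n := by
  classical
  intro n hn
  have hmat : ∀ b ∈ domBonds F Mc k K X, chartMat F K u b = chartMat F K u' b := by
    intro b hb
    refine Finset.sum_congr rfl fun a _ => ?_
    rw [h (chartEquiv F K (b, a)) (by simpa [recordCX] using hb)]
  simp only [recordCoords, Finset.mem_filter, Finset.mem_univ, true_and] at hn
  unfold recordChart encodeCfg
  rcases hc : ((cfgEquiv F K).symm n).1 with b | b
  · rw [hc] at hn
    simp only [Sum.elim_inl, id] at hn ⊢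
    rw [if_pos hn, if_pos hn, hmat b hn]
  · simp only [Sum.elim_inr]

/-- **The chart origin is the UNIT configuration** `(𝐔, 𝐉) = (1, 0)` (the flat point of (4.4) ∕ (O2′)). [cite: Balaban1987RG1, (4.4) p.281] -/
theorem decodeCfg_recordChart_zero (Mc k K : ℕ) (X : (recordDomSys F Mc k K).Dom) :
    decodeCfg F K (recordChart F Mc k K X 0) = (fun _ => 1, fun _ => 0) := by
  classical
  have h0 : ∀ b, chartMat F K 0 b = 0 := fun b => by simp [chartMat]
  simp [recordChart, h0]

/-! ## §3  The faces: ROW Gk, ROW (W-labels), ROW (N), ROW (Mc), the nearest cube, `recordAd` -/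

variable (θ : Stage13Params F 2)

/-- **ROW Gk face** (`rfl`): the responses ARE the derivative of the coordinate embedding on the basis fields. [cite: Balaban1987RG1, (4.35) p.290 (bookkeeping)] -/
theorem recordGk_eq (k K : ℕ) (a : θ.ιβ) (l : RespLabel F k K) (i : Fin (recordChartDim F K)) :
    recordGk F θ k K a l i =
      (letI := θ.instVβ₁; letI := θ.instVβ₂; letI := θ.instιβ
       fderiv ℝ (recordEmb F θ k K) 0 (Pi.single l.1 (Pi.single l.2 (θ.bV a))) i) := rfl

/-- **ROW (W-labels) face** (`rfl`). [cite: Balaban1987RG1, (1.20) p.264 (bookkeeping)] -/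
theorem recordE_eq (k K : ℕ) (μ : Fin 4) (z : Fin 4 → ℤ) :
    recordE F k K μ z = (Fin.cast (F.P_d K).symm μ, siteOfInt F K (k + 1) (-z)) := rfl

/-- **ROW (N) face** (`rfl`): the record's window is the whole unit torus. [cite: Balaban1987RG1, (1.21) p.264 (bookkeeping)] -/
theorem recordN_eq (k K : ℕ) : recordN F k K = (F.P K).sitesPerDir (k + 1) := rfl

/-- **ROW (Mc)**: some catalogue letter is admissible (`Mc := 1 = L^0`). [cite: Balaban1987RG1, p.257 (bookkeeping)] -/
theorem rowMc : ∃ Mc : ℕ, McGuard F Mc := ⟨1, 0, (pow_zero _).symm⟩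

/-- The record's own cube letter `L ^ j` is admissible. [cite: Balaban1987RG1, p.257 (bookkeeping)] -/
theorem mcGuard_pow (j : ℕ) : McGuard F (F.L ^ j) := ⟨j, rfl⟩

/-- The nearest cube lies in `X` and minimises the distance. [cite: Balaban1987RG1, p.257 (bookkeeping)] -/
theorem recordPick_spec (Mc k K : ℕ) (l : RespLabel F k K) (X : (recordDomSys F Mc k K).Dom) :
    recordPick F Mc k K l X ∈ (X.1 : Finset _) ∧
      ∀ c ∈ (X.1 : Finset _), recordDistC F Mc k K l (recordPick F Mc k K l X) ≤ recordDistC F Mc k K l c :=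
  Classical.choose_spec (Finset.exists_min_image (X.1 : Finset _) (recordDistC F Mc k K l) X.2.1)

/-- `dist(y, X)` is attained: it is bounded by the distance to every cube of `X`. [cite: Balaban1987RG1, p.257 (bookkeeping)] -/
theorem recordSiteGeom_distD_le (Mc k K : ℕ) (l : RespLabel F k K) (X : (recordDomSys F Mc k K).Dom)
    {c : (recordCc F Mc k K).Cube} (hc : c ∈ (X.1 : Finset _)) : (recordSiteGeom F Mc k K).distD l X ≤ recordDistC F Mc k K l c :=
  (recordPick_spec F Mc k K l X).2 c hc

/-- `recordAd` acts as `recordAdFun`. [cite: Balaban1987RG1, (4.8) p.283 (bookkeeping)] -/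
@[simp] theorem recordAd_apply (K : ℕ) (g : SU 2) (w : Fin (recordChartDim F K) → ℂ) : recordAd F K g w = recordAdFun F K g w := rfl

/-! ## §4  Linearity of the chart data -/

/-- `sl2Coord` is additive. [cite: Balaban1987RG1, (1.10) p.262 (bookkeeping)] -/
theorem sl2Coord_add (A B : MatA 2) : sl2Coord (A + B) = sl2Coord A + sl2Coord B := by
  ext a
  fin_cases a <;> simp [sl2Coord]
  ring

/-- `sl2Coord` is homogeneous. [cite: Balaban1987RG1, (1.10) p.262 (bookkeeping)] -/
theorem sl2Coord_smul (c : ℂ) (A : MatA 2) : sl2Coord (c • A) = c • sl2Coord A := by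
  ext a
  fin_cases a <;> simp [sl2Coord]
  ring

/-- `chartMat` is additive in the coordinates. [cite: Balaban1987RG1, p.258 (bookkeeping)] -/
theorem chartMat_add (K : ℕ) (w w' : Fin (recordChartDim F K) → ℂ) (b : PBond (F.P K) 0) :
    chartMat F K (w + w') b = chartMat F K w b + chartMat F K w' b := by
  simp [chartMat, add_smul, Finset.sum_add_distrib]

/-- `chartMat` is homogeneous in the coordinates. [cite: Balaban1987RG1, p.258 (bookkeeping)] -/
theorem chartMat_smul (K : ℕ) (c : ℂ) (w : Fin (recordChartDim F K) → ℂ) (b : PBond (F.P K) 0) :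
    chartMat F K (c • w) b = c • chartMat F K w b := by
  simp [chartMat, Finset.smul_sum, smul_smul]

/-! ## §5  (v2) The VOLUME SHIFT `recordK₀`: from it on, the `Mc`-cubes tile the torus exactly (CRIT-1 l.3621 (δ)) -/

variable {F} in
/-- **From `recordK₀` on, the cube side divides the torus side**: `L^{k+1} · Mc ∣ 2L^{m+K}` for an admissible `Mc = L^c` and `K ≥ k + 1 + c`.
[cite: Balaban1987RG1, p.257 (the cubes π_j tile the torus)] -/
theorem pow_mul_dvd_sitesPerDir {Mc k K : ℕ} (hMc : McGuard F Mc) (hK : recordK₀ F Mc k ≤ K) :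
    F.L ^ (k + 1) * Mc ∣ (F.P K).sitesPerDir 0 := by
  obtain ⟨c, rfl⟩ := hMc
  have hL : 1 < F.L := F.hL.2
  have hlog : Nat.log F.L (F.L ^ c) = c := Nat.log_pow hL c
  simp only [recordK₀, hlog] at hK
  rw [T4Family.sitesPerDir_eq, ← pow_add]
  exact Dvd.dvd.mul_left (pow_dvd_pow F.L (by omega)) 2

/-- Exact tiling arithmetic: `(⌈n ∕ s⌉ =) ((n − 1) ∕ s + 1) · s = n` when `s ∣ n ≠ 0` (11b's ceiling convention `Sect2.domCount`). [folklore] -/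
theorem pred_div_add_one_mul_of_dvd {n s : ℕ} (hs : s ∣ n) (hn : n ≠ 0) : ((n - 1) / s + 1) * s = n := by
  obtain ⟨q, rfl⟩ := hs
  have hs0 : 0 < s := Nat.pos_of_ne_zero (by rintro rfl; simp at hn)
  obtain ⟨q', rfl⟩ : ∃ q', q = q' + 1 := Nat.exists_eq_succ_of_ne_zero (by rintro rfl; simp at hn)
  have h1 : s * (q' + 1) - 1 = s * q' + (s - 1) := by
    rw [Nat.mul_succ, Nat.add_sub_assoc hs0]
  rw [h1, Nat.mul_add_div hs0, Nat.div_eq_of_lt (Nat.sub_lt hs0 Nat.one_pos), Nat.add_zero, mul_comm]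

variable {F} in
/-- **EXACT TILING from `recordK₀` on**: the number of `Mc`-cubes of `T^{(k+1)}` per direction times the cube side (in fine sites) IS the torus side — no partial cube,
the index torus of `recordDomSys F Mc k K` is the geometric one (11b's located reading (ℓ1) discharged on this range). [cite: Balaban1987RG1, p.257 (the cubes π_j tile the torus)] -/
theorem domCount_mul_side_eq {Mc k K : ℕ} (hMc : McGuard F Mc) (hK : recordK₀ F Mc k ≤ K) :
    Sect2.domCount (F.P K) Mc (k + 1) * (F.L ^ (k + 1) * Mc) = (F.P K).sitesPerDir 0 :=
  pred_div_add_one_mul_of_dvd (pow_mul_dvd_sitesPerDir hMc hK) ((F.P K).sitesPerDir_ne_zero 0)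

variable {F} in
/-- ROW (Mc) in COFINAL form (CRIT-1 l.3624's `rowMc_cofinal`, lens-1 v12 `RowMcCofinal`): admissible letters are unbounded. [cite: Balaban1987RG1, p.257 (bookkeeping)] -/
theorem rowMc_cofinal (Mth : ℕ) : ∃ Mc, Mth ≤ Mc ∧ McGuard F Mc :=
  ⟨F.L ^ Mth, (Nat.lt_pow_self F.hL.2).le, Mth, rfl⟩

/-! ## §6  (v3) ROW (LeavesT) at the names = the tree's `hTree_torus`; the (4.4) domain `recordDom44` is CONVEX, BALANCED, OPEN and contains `0`
(four of the six conjuncts of the repaired 27932‴ ∕ `Chart44DAt`, discharged outright) -/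

/-- **ROW (LeavesT) AT THE NAMES**: the tree leaf (0.26) for the record's cube cover at every `κ ≥ κ₀(4·2⁴, 8)`, constant `K₀(4·2⁴, 8)` uniform in `k`, `K`, `Mc`
and every letter — the tree's `TreeLengthTorus.hTree_torus`, nothing else. [cite: Balaban1987RG1, (0.26) pp.257–258] -/
theorem treeLeaf_recordCc {κ : ℝ} (hκ : B12TreeDecay.kappa₀ (4 * 2 ^ 4) (2 * 4) ≤ κ) (Mc k K : ℕ) :
    B12Decay510.TreeLeaf (recordCc F Mc k K) κ (B12TreeDecay.K₀ (4 * 2 ^ 4) (2 * 4)) :=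
  TreeLengthTorus.hTree_torus (F.P K).d (Sect2.domCount (F.P K) Mc (k + 1)) hκ

/-- The tree-leaf constant is non-negative. [cite: Balaban1987RG1, (0.26) p.257 (bookkeeping)] -/
theorem K₀_treeLeaf_nonneg : 0 ≤ B12TreeDecay.K₀ (4 * 2 ^ 4) (2 * 4) := by
  unfold B12TreeDecay.K₀
  positivity

/-- `w ↦ chartMat F K w b` as a `ℂ`-linear map. [cite: Balaban1987RG1, p.258 (bookkeeping)] -/
def chartMatLM (K : ℕ) (b : PBond (F.P K) 0) : (Fin (recordChartDim F K) → ℂ) →ₗ[ℂ] MatA 2 where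
  toFun w := chartMat F K w b
  map_add' w w' := chartMat_add F K w w' b
  map_smul' c w := chartMat_smul F K c w b

/-- `chartMatLM` evaluates to `chartMat`. [cite: Balaban1987RG1, p.258 (bookkeeping)] -/
@[simp] theorem chartMatLM_apply (K : ℕ) (b : PBond (F.P K) 0) (w : Fin (recordChartDim F K) → ℂ) :
    chartMatLM F K b w = chartMat F K w b := rfl

/-- A strict norm sublevel set of a linear map is convex. [folklore] -/
theorem convex_normLt {m : ℕ} (L : (Fin m → ℂ) →ₗ[ℂ] MatA 2) (r : ℝ) : Convex ℝ {w : Fin m → ℂ | ‖L w‖ < r} := by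
  have h : {w : Fin m → ℂ | ‖L w‖ < r} = (L.restrictScalars ℝ) ⁻¹' Metric.ball 0 r := by
    ext w; simp
  rw [h]
  exact (convex_ball 0 r).linear_preimage _

/-- A strict norm sublevel set of a linear map is balanced. [folklore] -/
theorem balanced_normLt {m : ℕ} (L : (Fin m → ℂ) →ₗ[ℂ] MatA 2) (r : ℝ) : Balanced ℂ {w : Fin m → ℂ | ‖L w‖ < r} := by
  intro a ha
  rintro _ ⟨w, hw, rfl⟩
  have hw' : ‖L w‖ < r := hw
  show ‖L (a • w)‖ < r
  rw [map_smul, norm_smul]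
  exact (mul_le_of_le_one_left (norm_nonneg _) ha).trans_lt hw'

/-- A strict norm sublevel set of a linear map (finite dimensions) is open. [folklore] -/
theorem isOpen_normLt {m : ℕ} (L : (Fin m → ℂ) →ₗ[ℂ] MatA 2) (r : ℝ) : IsOpen {w : Fin m → ℂ | ‖L w‖ < r} :=
  isOpen_lt (continuous_norm.comp L.continuous_of_finiteDimensional) continuous_const

/-- A guarded condition set `{w | c → w ∈ S}` keeps convexity, balancedness and openness. [folklore] -/
theorem convex_balanced_isOpen_imp {m : ℕ} {c : Prop} {S : Set (Fin m → ℂ)} (h : Convex ℝ S ∧ Balanced ℂ S ∧ IsOpen S) :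
    Convex ℝ {w : Fin m → ℂ | c → w ∈ S} ∧ Balanced ℂ {w : Fin m → ℂ | c → w ∈ S} ∧ IsOpen {w : Fin m → ℂ | c → w ∈ S} := by
  by_cases hc : c
  · have : {w : Fin m → ℂ | c → w ∈ S} = S := by ext w; simp [hc]
    rw [this]; exact h
  · have : {w : Fin m → ℂ | c → w ∈ S} = Set.univ := by ext w; simp [hc]
    rw [this]; exact ⟨convex_univ, balanced_univ, isOpen_univ⟩

/-- `recordDom44` as a finite intersection of guarded strict norm sublevel sets of linear maps of the chart coordinates. [cite: Balaban1987RG1, (4.4) p.281 (bookkeeping)] -/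
theorem recordDom44_eq_iInter (Mc k K : ℕ) (X : (recordDomSys F Mc k K).Dom) (α₂ : ℝ) :
    recordDom44 F Mc k K X α₂ =
      (⋂ b : PBond (F.P K) 0, {w | b ∈ domBonds F Mc k K X → w ∈ {w | ‖chartMatLM F K b w‖ < α₂ * (F.P K).eta (k + 1)}}) ∩
      (⋂ b : PBond (F.P K) 0, ⋂ μ : Fin (F.P K).d, {w | (b ∈ domBonds F Mc k K X ∧ (⟨b.src.shift μ, b.dir⟩ : PBond (F.P K) 0) ∈ domBonds F Mc k K X) →
        w ∈ {w | ‖(chartMatLM F K ⟨b.src.shift μ, b.dir⟩ - chartMatLM F K b) w‖ < α₂ * (F.P K).eta (k + 1) ^ 2}}) ∩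
      (⋂ b : PBond (F.P K) 0, {w | (b ∈ domBonds F Mc k K X ∧ ∀ μ : Fin (F.P K).d, (⟨b.src.shift μ, b.dir⟩ : PBond (F.P K) 0) ∈ domBonds F Mc k K X ∧
          (⟨b.src.unshift μ, b.dir⟩ : PBond (F.P K) 0) ∈ domBonds F Mc k K X) →
        w ∈ {w | ‖(∑ μ : Fin (F.P K).d, (chartMatLM F K ⟨b.src.shift μ, b.dir⟩ - (2 : ℂ) • chartMatLM F K b + chartMatLM F K ⟨b.src.unshift μ, b.dir⟩)) w‖ <
          α₂ * (F.P K).eta (k + 1) ^ 3}}) := by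
  ext w
  simp only [recordDom44, Set.mem_setOf_eq, Set.mem_inter_iff, Set.mem_iInter, chartMatLM_apply, LinearMap.sub_apply, LinearMap.coe_sum,
    Finset.sum_apply, LinearMap.add_apply, LinearMap.smul_apply, and_imp]
  constructor
  · rintro ⟨h1, h2, h3⟩
    exact ⟨⟨h1, fun b μ hb hμ => h2 b hb μ hμ⟩, fun b hb hμ => h3 b hb hμ⟩
  · rintro ⟨⟨h1, h2⟩, h3⟩
    exact ⟨h1, fun b hb μ hμ => h2 b μ hb hμ, fun b hb hμ => h3 b hb hμ⟩

/-- **`recordDom44` is CONVEX, BALANCED and OPEN** (three conjuncts of `Chart44DAt`, discharged). [cite: Balaban1987RG1, (4.4) p.281] -/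
theorem convex_balanced_isOpen_recordDom44 (Mc k K : ℕ) (X : (recordDomSys F Mc k K).Dom) (α₂ : ℝ) :
    Convex ℝ (recordDom44 F Mc k K X α₂) ∧ Balanced ℂ (recordDom44 F Mc k K X α₂) ∧ IsOpen (recordDom44 F Mc k K X α₂) := by
  rw [recordDom44_eq_iInter]
  have key : ∀ {c : Prop} (L : (Fin (recordChartDim F K) → ℂ) →ₗ[ℂ] MatA 2) (r : ℝ),
      Convex ℝ {w : Fin (recordChartDim F K) → ℂ | c → w ∈ {w | ‖L w‖ < r}} ∧ Balanced ℂ {w : Fin (recordChartDim F K) → ℂ | c → w ∈ {w | ‖L w‖ < r}} ∧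
        IsOpen {w : Fin (recordChartDim F K) → ℂ | c → w ∈ {w | ‖L w‖ < r}} :=
    fun L r => convex_balanced_isOpen_imp ⟨convex_normLt L r, balanced_normLt L r, isOpen_normLt L r⟩
  refine ⟨?_, ?_, ?_⟩
  · exact ((convex_iInter fun b => (key _ _).1).inter (convex_iInter fun b => convex_iInter fun μ => (key _ _).1)).inter
      (convex_iInter fun b => (key _ _).1)
  · exact ((balanced_iInter fun b => (key _ _).2.1).inter (balanced_iInter fun b => balanced_iInter fun μ => (key _ _).2.1)).inter
      (balanced_iInter fun b => (key _ _).2.1)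
  · exact ((isOpen_iInter_of_finite fun b => (key _ _).2.2).inter
      (isOpen_iInter_of_finite fun b => isOpen_iInter_of_finite fun μ => (key _ _).2.2)).inter
      (isOpen_iInter_of_finite fun b => (key _ _).2.2)

/-- **`0 ∈ recordDom44` for `α₂ > 0`** (the chart origin = the unit configuration lies in print's (4.4) domain). [cite: Balaban1987RG1, (4.4) p.281] -/
theorem zero_mem_recordDom44 (Mc k K : ℕ) (X : (recordDomSys F Mc k K).Dom) {α₂ : ℝ} (hα : 0 < α₂) :
    (0 : Fin (recordChartDim F K) → ℂ) ∈ recordDom44 F Mc k K X α₂ := by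
  have h0 : ∀ b, chartMat F K 0 b = 0 := fun b => by simp [chartMat]
  have hξ : 0 < (F.P K).eta (k + 1) := by
    unfold Params.eta
    have hL : (0 : ℝ) < (F.P K).L := by exact_mod_cast (F.P K).L_pos
    positivity
  refine ⟨fun b _ => ?_, fun b _ μ _ => ?_, fun b _ _ => ?_⟩
  · simpa [h0] using mul_pos hα hξ
  · simpa [h0] using mul_pos hα (pow_pos hξ 2)
  · simpa [h0] using mul_pos hα (pow_pos hξ 3)

/-! ## §7  (v3) Agreement with typer-1's tree moulds: `Chart44DAt` IS `B12FormatPlus.Chart44D` at the names; NamesAgree′ for the record response data -/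

/-- **The receipt `Chart44DAt` IS typer-1's mould `B12FormatPlus.Chart44D` (v5 ✓p793008) at the names** (`Iff.rfl`). [cite: Balaban1987RG1, (4.4) p.281 (bookkeeping)] -/
theorem chart44DAt_iff (Mc k : ℕ) (α₀ α₁ α₂ : ℝ) :
    Chart44DAt F Mc k α₀ α₁ α₂ ↔
      B12FormatPlus.Chart44D (recordDomSys F Mc k) (recordBondCount F) (recordUc F Mc k α₀ α₁) (recordChartDim F) (recordChart F Mc k)
        (fun K X => recordDom44 F Mc k K X α₂) := Iff.rfl

/-- NamesAgree′ for the CENTRED record response data (`rfl`). [cite: Balaban1987RG1, (1.7) p.261, (1.21) p.264 (bookkeeping)] -/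
theorem recordResponse9DataCtr_namesAgree (a : θ.ιβ) (Mc k : ℕ) :
    (recordResponse9DataCtr F θ a Mc k).wrap = recordWrapCtr F Mc k ∧ (recordResponse9DataCtr F θ a Mc k).emb = recordDomEmbCtr F Mc k ∧
      (recordResponse9DataCtr F θ a Mc k).πc = fun K _ => recordCoordProjCtr F K := ⟨rfl, rfl, rfl⟩

/-- NamesAgree′ for the CENTRED record response data from a base volume (`rfl`). [cite: Balaban1987RG1, (1.7) p.261, (1.21) p.264 (bookkeeping)] -/
theorem recordResponse9DataFromCtr_namesAgree (a : θ.ιβ) (Mc k K₀ : ℕ) :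
    (recordResponse9DataFromCtr F θ a Mc k K₀).wrap = (fun n => recordWrapCtr F Mc k (K₀ + n)) ∧
      (recordResponse9DataFromCtr F θ a Mc k K₀).emb = (fun n => recordDomEmbCtr F Mc k (K₀ + n)) ∧
      (recordResponse9DataFromCtr F θ a Mc k K₀).πc = fun n _ => recordCoordProjCtr F (K₀ + n) := ⟨rfl, rfl, rfl⟩

/-! ## §8  (v3) The CENTRED window: the base cube is off the seam, the seam is at distance `≥ recordR ≥ N∕4`, and the centred lift carries window labels to window labels -/

/-- The base label's cube is the cube `0`. [cite: Balaban1987RG1, (1.21) p.264 (bookkeeping)] -/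
theorem cubeIdxOf_recordE_zero (Mc k K : ℕ) (μ : Fin 4) : cubeIdxOf F Mc k K (recordE F k K μ 0).2 = 0 := by
  funext i
  simp [cubeIdxOf, recordE, siteOfInt]

/-- On an index torus `ZMod q`, an antipodal residue (`valMinAbs = ⌊q∕2⌋`) is at torus distance `⌊q∕2⌋` from `0`. [folklore] -/
theorem half_le_min_val_of_valMinAbs_eq {q : ℕ} [NeZero q] (x : ZMod q) (hx : x.valMinAbs = ((q / 2 : ℕ) : ℤ)) :
    q / 2 ≤ min (0 - x).val (x - 0).val := by
  rw [zero_sub, sub_zero]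
  have hv : x.val = q / 2 := by
    have h := ZMod.valMinAbs_def_pos x
    rw [hx] at h
    split_ifs at h with hle
    · exact_mod_cast h.symm
    · have : (x.val : ℤ) - q = (q / 2 : ℕ) := h.symm
      have hlt := ZMod.val_lt x
      omega
  rw [ZMod.neg_val, hv]
  split_ifs with h0
  · have : q / 2 = 0 := by rw [← hv, h0, ZMod.val_zero]
    simp [this]
  · exact le_min (by omega) le_rfl

/-- **Every seam cube is at distance `≥ recordR` from the base label** (in the units of `recordDistC`). [cite: Balaban1987RG1, (1.21) p.264] -/
theorem recordR_le_distC_of_onSeamCtr (Mc k K : ℕ) (μ : Fin 4) {c : (recordCc F Mc k K).Cube} (hc : OnSeamCtr c) :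
    recordR F Mc k K ≤ recordDistC F Mc k K (recordE F k K μ 0) c := by
  obtain ⟨i, hi⟩ := hc
  unfold recordR recordDistC
  rw [cubeIdxOf_recordE_zero]
  refine mul_le_mul_of_nonneg_left ?_ (Nat.cast_nonneg _)
  have h1 : Sect2.domCount (F.P K) Mc (k + 1) / 2 ≤ min ((0 : TPt (F.P K).d _) i - c i).val (c i - (0 : TPt (F.P K).d _) i).val :=
    half_le_min_val_of_valMinAbs_eq (c i) hi
  have h2 : min ((0 : TPt (F.P K).d _) i - c i).val (c i - (0 : TPt (F.P K).d _) i).val ≤ idxDist 0 c :=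
    Finset.single_le_sum (f := fun j => min ((0 : TPt (F.P K).d _) j - c j).val (c j - (0 : TPt (F.P K).d _) j).val)
      (fun _ _ => Nat.zero_le _) (Finset.mem_univ i)
  exact_mod_cast h1.trans h2

variable {F} in
/-- `N = q · Mc` on the exactly-tiled range: the unit torus `T^{(k+1)}` has `domCount · Mc` sites per direction. [cite: Balaban1987RG1, p.257 (bookkeeping)] -/
theorem recordN_eq_domCount_mul {Mc k K : ℕ} (hMc : McGuard F Mc) (hK : recordK₀ F Mc k ≤ K) :
    recordN F k K = Sect2.domCount (F.P K) Mc (k + 1) * Mc := by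
  have htile := domCount_mul_side_eq hMc hK
  have hk : k + 1 ≤ F.m + K := by unfold recordK₀ at hK; omega
  have hrec : recordN F k K = 2 * F.L ^ (F.m + K - (k + 1)) := by
    simp [recordN, Params.sitesPerDir, T4Family.P, Missing.params4]
  have harith : 2 * F.L ^ (F.m + K) = F.L ^ (k + 1) * (2 * F.L ^ (F.m + K - (k + 1))) := by
    rw [mul_left_comm, ← pow_add, Nat.add_sub_cancel' hk]
  have hL : 0 < F.L ^ (k + 1) := pow_pos (by have := F.hL.2; omega) _
  rw [T4Family.sitesPerDir_eq, harith, ← hrec] at htile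
  have h2 : F.L ^ (k + 1) * (Sect2.domCount (F.P K) Mc (k + 1) * Mc) = F.L ^ (k + 1) * recordN F k K := by
    rw [← htile]; ring
  exact (Nat.eq_of_mul_eq_mul_left hL h2).symm

variable {F} in
/-- **`N ∕ 4 ≤ recordR`** on the exactly-tiled range once the torus has at least two cubes per direction. [cite: Balaban1987RG1, (1.21) p.264] -/
theorem recordN_div_four_le_recordR {Mc k K : ℕ} (hMc : McGuard F Mc) (hK : recordK₀ F Mc k ≤ K) (hq : 2 ≤ Sect2.domCount (F.P K) Mc (k + 1)) :
    (recordN F k K : ℝ) / 4 ≤ recordR F Mc k K := by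
  rw [recordN_eq_domCount_mul hMc hK, recordR]
  set q := Sect2.domCount (F.P K) Mc (k + 1)
  have hq2 : (q : ℝ) ≤ 4 * ((q / 2 : ℕ) : ℝ) := by
    have : q ≤ 4 * (q / 2) := by omega
    exact_mod_cast this
  have hMc0 : (0 : ℝ) ≤ Mc := Nat.cast_nonneg _
  push_cast
  nlinarith

/-- **The centred lift carries window labels to window labels**: for `2|z_i| < N`, the centred lift of the site `−z` of `T_K` is the site `−z` of `T_{K+1}`.
[cite: Balaban1987RG1, (1.21) p.264] -/
theorem liftSiteCtr_siteOfInt_neg (K j : ℕ) (z : Fin 4 → ℤ) (hz : ∀ i, 2 * |z i| < ((F.P K).sitesPerDir j : ℤ)) :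
    liftSiteCtr F K j (siteOfInt F K j (-z)) = siteOfInt F (K + 1) j (-z) := by
  funext μ
  simp only [liftSiteCtr, siteOfInt, Pi.neg_apply]
  have h : (((-z (Fin.cast (F.P_d K) μ) : ℤ) : ZMod ((F.P K).sitesPerDir j))).valMinAbs = -z (Fin.cast (F.P_d K) μ) := by
    rw [ZMod.valMinAbs_spec]
    have hzμ := hz (Fin.cast (F.P_d K) μ)
    have h1 := neg_abs_le (z (Fin.cast (F.P_d K) μ))
    have h2 := le_abs_self (z (Fin.cast (F.P_d K) μ))
    exact ⟨by push_cast; ring, Set.mem_Ioc.2 ⟨by linarith, by linarith⟩⟩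
  rw [h]
  rfl

end Summit.QuantumFields.YangMills.Theorems.K0RecordFormatNames

end
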